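import Literature.Geometry.Riemannian.PinchingEstimatesCriticalPairs
import Literature.Geometry.Riemannian.PinchingEstimatesFrobenius
import Literature.Geometry.Riemannian.PinchingEstimatesPreserved
import HarnessLib

/-!
# Hamilton 1997, Thm. 1.7 at the extremal unit vectors: the pointwise differential inequality
(topic `Geometry/Riemannian`)

Part of the decomposition of `Literature.Geometry.Riemannian.hamilton_chenZhu_pinching`
(`PinchingEstimates.lean`). Hamilton 1997, §2.1, Thm. 1.7 (pp. 10–11): "If the previous
estimates `max(a₃, b₃, c₃) ≤ Ξ(a₁ + a₂)` and `max(a₃, b₃, c₃) ≤ Ξ(c₁ + c₂)` hold and `a₁ + ρ > 0`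
and `c₁ + ρ > 0` and if `Ψ` is any constant with `Ψ ≥ 4Ξ² + 1` then the estimates
`a₃ ≤ Ψ(a₁ + ρ)` and `c₃ ≤ Ψ(c₁ + ρ)` are preserved by the Ricci flow. Proof. Since
`a₁ + a₂ ≤ 2a₂` we have `max(a₃, b₃, c₃) ≤ 2Ξa₂`. Now `a₃² ≤ 4Ξ²a₂²` and `b₃² ≤ 4Ξ²a₂²` and
`2a₁a₂ ≤ 2a₂²` and `d a₃/dt ≤ a₃² + 2a₁a₂ + b₃² ≤ (8Ξ² + 2)a₂²` … On the other hand
`d/dt (a₁ + ρ) ≥ a₁² + 2a₂a₃ + b₁² ≥ 2a₂a₃` … Then the inequality is preserved if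
`2Ψ ≥ 8Ξ² + 2`."

In the tree's variational language (`Matrix.LargestLESmallestAdd Ψ ρ`: `uᵀAu ≤ Ψ(wᵀAw + ρ)`
for all unit `u, w`) the preserved quantity is the minimum over `(u, w) ∈ unitSet × unitSet`
of `G = Ψ(wᵀAw + ρ) - uᵀAu`; at a minimiser `w` minimises the Rayleigh quotient (`a₁`) and
`u` maximises it (`a₃`). PROVED here: the decoupling, the eigenvector property of extremal
unit vectors, the evaluation `e₃ᵀA'e₃ = d₃² + |ᵗBe₃|² + 2d₁d₂` of `A' = A² + BᵗB + 2A^#` in an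
orthonormal basis diagonalising the form (`quad_field_eq_of_diag`), and **Hamilton's
inequality in the strong pointwise form** `largest_deriv_nonneg`:
`Ψ · wᵀA'w - uᵀA'u ≥ 0` at the extremal pair whenever `Ψ ≥ 4Ξ² + 1` — Hamilton's two
log-derivative bounds share the factor `a₂a₃`, so no boundary condition is needed.

## References

* R. S. Hamilton, Comm. Anal. Geom. 5 (1997), §2.1, Thm. 1.7 and its proof (pp. 10–11). [Hamilton1997]
-/

noncomputable section

open Set Real
open scoped Matrix BigOperators

namespace Literature.Geometry.Riemannian

namespace HamiltonODE

variable {M N : Matrix (Fin 3) (Fin 3) ℝ}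

/-! ### The functional and the extremal unit vectors -/

/-- Hamilton's Thm. 1.7 functional `G = Ψ(wᵀMw + ρ) - uᵀMu` on `unitSet × unitSet`,
`p = (u, w)`. [folklore] -/
def largestG (Ψ ρ : ℝ) (M : Matrix (Fin 3) (Fin 3) ℝ) (p : (Fin 3 → ℝ) × (Fin 3 → ℝ)) : ℝ :=
  Ψ * (p.2 ⬝ᵥ (M *ᵥ p.2) + ρ) - p.1 ⬝ᵥ (M *ᵥ p.1)

/-- `a₃ ≤ Ψ(a₁ + ρ)` iff `G ≥ 0` on `unitSet × unitSet`. [folklore] -/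
theorem largestLESmallestAdd_iff (Ψ ρ : ℝ) (M : Matrix (Fin 3) (Fin 3) ℝ) :
    M.LargestLESmallestAdd Ψ ρ ↔ ∀ p ∈ unitSet ×ˢ unitSet, 0 ≤ largestG Ψ ρ M p := by
  constructor
  · rintro h ⟨u, w⟩ ⟨hu, hw⟩
    have := h u w hu hw
    simp only [largestG]; linarith
  · intro h u w hu hw
    have := h (u, w) ⟨hu, hw⟩
    simp only [largestG] at this; linarith

/-- At a minimiser of `G` (`Ψ > 0`), `w` minimises the Rayleigh quotient. [folklore] -/
theorem rayleigh_min_of_isMinOn_largestG {Ψ ρ : ℝ} (hΨ : 0 < Ψ) {p : (Fin 3 → ℝ) × (Fin 3 → ℝ)}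
    (hp : p ∈ unitSet ×ˢ unitSet) (hmin : IsMinOn (largestG Ψ ρ M) (unitSet ×ˢ unitSet) p) :
    ∀ z ∈ unitSet, p.2 ⬝ᵥ (M *ᵥ p.2) ≤ z ⬝ᵥ (M *ᵥ z) := by
  intro z hz
  have h := hmin (show (p.1, z) ∈ unitSet ×ˢ unitSet from ⟨hp.1, hz⟩)
  simp only [mem_setOf_eq, largestG] at h
  nlinarith

/-- At a minimiser of `G`, `u` maximises the Rayleigh quotient. [folklore] -/
theorem rayleigh_max_of_isMinOn_largestG {Ψ ρ : ℝ} {p : (Fin 3 → ℝ) × (Fin 3 → ℝ)}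
    (hp : p ∈ unitSet ×ˢ unitSet) (hmin : IsMinOn (largestG Ψ ρ M) (unitSet ×ˢ unitSet) p) :
    ∀ z ∈ unitSet, z ⬝ᵥ (M *ᵥ z) ≤ p.1 ⬝ᵥ (M *ᵥ p.1) := by
  intro z hz
  have h := hmin (show (z, p.2) ∈ unitSet ×ˢ unitSet from ⟨hz, hp.2⟩)
  simp only [mem_setOf_eq, largestG] at h
  linarith

/-- **An extremal unit vector of the Rayleigh quotient is an eigenvector**: `uᵀMz = 0` for all
`z ⊥ u` (minimum case). [folklore] -/
theorem cross_eq_zero_of_min (hM : M.IsSymm) {u : Fin 3 → ℝ} (hu : u ⬝ᵥ u = 1)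
    (hmin : ∀ z ∈ unitSet, u ⬝ᵥ (M *ᵥ u) ≤ z ⬝ᵥ (M *ᵥ z)) {z : Fin 3 → ℝ} (hz : z ⬝ᵥ u = 0) :
    u ⬝ᵥ (M *ᵥ z) = 0 := by
  by_cases hz0 : z = 0
  · simp [hz0]
  have hzz : 0 < z ⬝ᵥ z := lt_of_le_of_ne (Finset.sum_nonneg fun i _ ↦ mul_self_nonneg _)
    (fun h ↦ hz0 (dotProduct_self_eq_zero.1 h.symm))
  set c := (z ⬝ᵥ z)⁻¹.sqrt with hc
  have hcpos : 0 < c := Real.sqrt_pos.2 (inv_pos.2 hzz)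
  have hy : (c • z) ⬝ᵥ (c • z) = 1 := normalize_dot_self hz0
  have huy : u ⬝ᵥ (c • z) = 0 := by rw [dotProduct_smul, dotProduct_comm, hz, smul_zero]
  have h := (firstOrder_of_min hM (u := u) (y := c • z) fun t ↦
    hmin _ (variation_mem hu hy huy t)).1
  rw [Matrix.mulVec_smul, dotProduct_smul, smul_eq_mul] at h
  exact (mul_eq_zero.1 h).resolve_left hcpos.ne'

/-- **An extremal unit vector of the Rayleigh quotient is an eigenvector** (maximum case). [folklore] -/
theorem cross_eq_zero_of_max (hM : M.IsSymm) {u : Fin 3 → ℝ} (hu : u ⬝ᵥ u = 1)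
    (hmax : ∀ z ∈ unitSet, z ⬝ᵥ (M *ᵥ z) ≤ u ⬝ᵥ (M *ᵥ u)) {z : Fin 3 → ℝ} (hz : z ⬝ᵥ u = 0) :
    u ⬝ᵥ (M *ᵥ z) = 0 := by
  have h := cross_eq_zero_of_min hM.neg hu (fun z hz ↦ by
    have := hmax z hz
    rw [Matrix.neg_mulVec, Matrix.neg_mulVec, dotProduct_neg, dotProduct_neg]; linarith) hz
  rwa [Matrix.neg_mulVec, dotProduct_neg, neg_eq_zero] at h

/-- Eigenvectors of a symmetric matrix with different Rayleigh quotients are orthogonal. [folklore] -/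
theorem dot_eq_zero_of_eigen (hM : M.IsSymm) {u w : Fin 3 → ℝ} (hu : u ⬝ᵥ u = 1) (hw : w ⬝ᵥ w = 1)
    (hu0 : ∀ z : Fin 3 → ℝ, z ⬝ᵥ u = 0 → u ⬝ᵥ (M *ᵥ z) = 0)
    (hw0 : ∀ z : Fin 3 → ℝ, z ⬝ᵥ w = 0 → w ⬝ᵥ (M *ᵥ z) = 0)
    (hne : w ⬝ᵥ (M *ᵥ w) ≠ u ⬝ᵥ (M *ᵥ u)) : u ⬝ᵥ w = 0 := by
  -- `uᵀMw = (w·u) uᵀMu` and `wᵀMu = (u·w) wᵀMw`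
  have h1 : u ⬝ᵥ (M *ᵥ w) = (w ⬝ᵥ u) * (u ⬝ᵥ (M *ᵥ u)) := by
    have hz : (w - (w ⬝ᵥ u) • u) ⬝ᵥ u = 0 := by
      rw [sub_dotProduct, smul_dotProduct, smul_eq_mul, hu, mul_one, sub_self]
    have := hu0 _ hz
    rw [Matrix.mulVec_sub, Matrix.mulVec_smul, dotProduct_sub, dotProduct_smul, smul_eq_mul] at this
    linarith
  have h2 : w ⬝ᵥ (M *ᵥ u) = (u ⬝ᵥ w) * (w ⬝ᵥ (M *ᵥ w)) := by
    have hz : (u - (u ⬝ᵥ w) • w) ⬝ᵥ w = 0 := by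
      rw [sub_dotProduct, smul_dotProduct, smul_eq_mul, hw, mul_one, sub_self]
    have := hw0 _ hz
    rw [Matrix.mulVec_sub, Matrix.mulVec_smul, dotProduct_sub, dotProduct_smul, smul_eq_mul] at this
    linarith
  rw [quad_comm_of_isSymm hM w u, h1, dotProduct_comm w u] at h2
  have : (u ⬝ᵥ w) * (w ⬝ᵥ (M *ᵥ w) - u ⬝ᵥ (M *ᵥ u)) = 0 := by linarith
  exact (mul_eq_zero.1 this).resolve_right (sub_ne_zero.2 hne)

/-! ### `A'` in a diagonalising orthonormal basis -/

/-- **`e₃ᵀA'e₃ = d₃² + |ᵗNe₃|² + 2d₁d₂`** for `A' = M² + NᵗN + 2M^#`, `M` symmetric, in an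
orthonormal basis `(e₁, e₂, e₃)` in which the form of `M` is diagonal with entries `dᵢ = eᵢᵀMeᵢ`
(Hamilton 1986, Lemma 6.1: "`A²(x, x) = a²`, `A^#(x₁, x₁) = a₂a₃`"). [cite: Hamilton1997, §2.1, Thm. 1.7 (proof, p. 11)] -/
theorem quad_field_eq_of_diag (hM : M.IsSymm) {e₁ e₂ e₃ : Fin 3 → ℝ} (h₁ : e₁ ⬝ᵥ e₁ = 1)
    (h₂ : e₂ ⬝ᵥ e₂ = 1) (h₃ : e₃ ⬝ᵥ e₃ = 1) (h₁₂ : e₁ ⬝ᵥ e₂ = 0) (h₁₃ : e₁ ⬝ᵥ e₃ = 0)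
    (h₂₃ : e₂ ⬝ᵥ e₃ = 0) (c₁₂ : e₁ ⬝ᵥ (M *ᵥ e₂) = 0) (c₁₃ : e₁ ⬝ᵥ (M *ᵥ e₃) = 0)
    (c₂₃ : e₂ ⬝ᵥ (M *ᵥ e₃) = 0) :
    e₃ ⬝ᵥ ((M * M + N * Nᵀ + (2 : ℝ) • M.sharp) *ᵥ e₃) =
      (e₃ ⬝ᵥ (M *ᵥ e₃)) ^ 2 + (Nᵀ *ᵥ e₃) ⬝ᵥ (Nᵀ *ᵥ e₃) +
        2 * ((e₁ ⬝ᵥ (M *ᵥ e₁)) * (e₂ ⬝ᵥ (M *ᵥ e₂))) := by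
  have c₂₁ : e₂ ⬝ᵥ (M *ᵥ e₁) = 0 := by rw [quad_comm_of_isSymm hM]; exact c₁₂
  have c₃₁ : e₃ ⬝ᵥ (M *ᵥ e₁) = 0 := by rw [quad_comm_of_isSymm hM]; exact c₁₃
  have c₃₂ : e₃ ⬝ᵥ (M *ᵥ e₂) = 0 := by rw [quad_comm_of_isSymm hM]; exact c₂₃
  have hP := fun y ↦ parseval_of_orthonormal h₁ h₂ h₃ h₁₂ h₁₃ h₂₃ y
  have n1 : (M *ᵥ e₁) ⬝ᵥ (M *ᵥ e₁) = (e₁ ⬝ᵥ (M *ᵥ e₁)) ^ 2 := by rw [hP, c₂₁, c₃₁]; ring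
  have n2 : (M *ᵥ e₂) ⬝ᵥ (M *ᵥ e₂) = (e₂ ⬝ᵥ (M *ᵥ e₂)) ^ 2 := by rw [hP, c₁₂, c₃₂]; ring
  have n3 : (M *ᵥ e₃) ⬝ᵥ (M *ᵥ e₃) = (e₃ ⬝ᵥ (M *ᵥ e₃)) ^ 2 := by rw [hP, c₁₃, c₂₃]; ring
  have htr : M.trace = e₁ ⬝ᵥ (M *ᵥ e₁) + e₂ ⬝ᵥ (M *ᵥ e₂) + e₃ ⬝ᵥ (M *ᵥ e₃) :=
    (sum_quadratic_eq_trace_of_orthonormal M h₁ h₂ h₃ h₁₂ h₁₃ h₂₃).symm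
  have htr2 : (M * M).trace =
      (e₁ ⬝ᵥ (M *ᵥ e₁)) ^ 2 + (e₂ ⬝ᵥ (M *ᵥ e₂)) ^ 2 + (e₃ ⬝ᵥ (M *ᵥ e₃)) ^ 2 := by
    rw [← sum_quadratic_eq_trace_of_orthonormal (M * M) h₁ h₂ h₃ h₁₂ h₁₃ h₂₃,
      quad_mul_self_of_isSymm hM, quad_mul_self_of_isSymm hM, quad_mul_self_of_isSymm hM, n1, n2, n3]
  rw [Matrix.add_mulVec, Matrix.add_mulVec, dotProduct_add, dotProduct_add, Matrix.smul_mulVec,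
    dotProduct_smul, smul_eq_mul, quad_sharp, quad_adjugate M e₃ h₃, quad_mul_self_of_isSymm hM,
    quad_mul_transpose_self, n3, htr2, htr]
  ring

/-- `|ᵗNu|²` is the square of a value `uᵀNv` at a unit `v` (or vanishes). [folklore] -/
theorem normSq_mulTranspose_le_sq_of_bound {u : Fin 3 → ℝ} {L : ℝ} (hL : 0 ≤ L)
    (h : ∀ v : Fin 3 → ℝ, v ⬝ᵥ v = 1 → u ⬝ᵥ (N *ᵥ v) ≤ L) :
    (Nᵀ *ᵥ u) ⬝ᵥ (Nᵀ *ᵥ u) ≤ L ^ 2 := by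
  by_cases hq : Nᵀ *ᵥ u = 0
  · rw [hq]; simp [sq_nonneg]
  have hqq : 0 < (Nᵀ *ᵥ u) ⬝ᵥ (Nᵀ *ᵥ u) := lt_of_le_of_ne
    (Finset.sum_nonneg fun i _ ↦ mul_self_nonneg _) (fun h ↦ hq (dotProduct_self_eq_zero.1 h.symm))
  set c := ((Nᵀ *ᵥ u) ⬝ᵥ (Nᵀ *ᵥ u))⁻¹.sqrt with hc
  have hv : (c • (Nᵀ *ᵥ u)) ⬝ᵥ (c • (Nᵀ *ᵥ u)) = 1 := normalize_dot_self hq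
  have hval : u ⬝ᵥ (N *ᵥ (c • (Nᵀ *ᵥ u))) = ((Nᵀ *ᵥ u) ⬝ᵥ (Nᵀ *ᵥ u)).sqrt := by
    rw [Matrix.mulVec_smul, dotProduct_smul, smul_eq_mul, Matrix.dotProduct_mulVec,
      ← Matrix.mulVec_transpose, hc, Real.sqrt_inv]
    field_simp
    rw [Real.sq_sqrt hqq.le]
  have h1 := h _ hv
  rw [hval] at h1
  nlinarith [Real.sq_sqrt hqq.le, Real.sqrt_nonneg ((Nᵀ *ᵥ u) ⬝ᵥ (Nᵀ *ᵥ u))]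

/-! ### Hamilton's inequality for `G = Ψ(wᵀMw + ρ) - uᵀMu` -/

/-- The scalar bookkeeping of Hamilton's proof of Thm. 1.7 (p. 11): with `x = a₁ ≤ a = a₂ ≤ y = a₃`,
`x + a > 0`, `y ≤ Ξ(x + a)`, `|ᵗNu|² ≤ (Ξ(x + a))²`:
`y² + |ᵗNu|² + 2xa ≤ (8Ξ² + 2)a² ≤ (8Ξ² + 2)ay ≤ Ψ · 2ay ≤ Ψ(x² + |ᵗNw|² + 2ay)`.
[cite: Hamilton1997, §2.1, Thm. 1.7 (proof, p. 11)] -/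
theorem largest_scalar {x a y Nu Nw Ξ Ψ : ℝ} (hΞ : 0 < Ξ) (hΨ : 4 * Ξ ^ 2 + 1 ≤ Ψ) (hxa : x ≤ a)
    (hay : a ≤ y) (hpos : 0 < x + a) (hy : y ≤ Ξ * (x + a)) (hNu : Nu ≤ (Ξ * (x + a)) ^ 2)
    (hNw : 0 ≤ Nw) : 0 ≤ Ψ * (x ^ 2 + Nw + 2 * (a * y)) - (y ^ 2 + Nu + 2 * (x * a)) := by
  have ha : 0 < a := by linarith
  have hy0 : 0 < y := by linarith
  have hs : x + a ≤ 2 * a := by linarith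
  have h1 : Ξ * (x + a) ≤ 2 * Ξ * a := by nlinarith
  have h0 : 0 ≤ Ξ * (x + a) := by positivity
  have h2 : (Ξ * (x + a)) ^ 2 ≤ 4 * Ξ ^ 2 * a ^ 2 := by nlinarith
  have h3 : y ^ 2 ≤ 4 * Ξ ^ 2 * a ^ 2 := by nlinarith
  have h4 : 2 * (x * a) ≤ 2 * a ^ 2 := by nlinarith
  have hup : y ^ 2 + Nu + 2 * (x * a) ≤ (8 * Ξ ^ 2 + 2) * a ^ 2 := by linarith
  have h5 : (8 * Ξ ^ 2 + 2) * a ^ 2 ≤ (8 * Ξ ^ 2 + 2) * (a * y) :=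
    mul_le_mul_of_nonneg_left (by nlinarith) (by positivity)
  have h6 : (8 * Ξ ^ 2 + 2) * (a * y) ≤ Ψ * (2 * (a * y)) := by
    have : 0 ≤ a * y := by positivity
    nlinarith
  have h7 : Ψ * (2 * (a * y)) ≤ Ψ * (x ^ 2 + Nw + 2 * (a * y)) :=
    mul_le_mul_of_nonneg_left (by nlinarith [sq_nonneg x]) (by nlinarith)
  linarith

/-- **Hamilton 1997, Thm. 1.7: the differential inequality at the extremal unit vectors.** Let
`M` be symmetric with `a₁ + a₂ ≥ m > 0` (`TwoSmallestEigenvaluesSumGE`), let the Rayleigh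
quotients and the values `u'ᵀNv'` be bounded by `Ξ` times the pair sums of `M` (the `M`-half of
`MaxLEPairSum`), `Ξ > 0`, `Ψ ≥ 4Ξ² + 1`, and let `w` minimise and `u` maximise the Rayleigh
quotient over unit vectors. Then `Ψ · wᵀM'w - uᵀM'u ≥ 0` for `M' = M² + NᵗN + 2M^#`
(Hamilton: `d a₃/dt ≤ (8Ξ² + 2)a₂² ≤ (8Ξ² + 2)a₂a₃` and `d(a₁ + ρ)/dt ≥ 2a₂a₃`).
[cite: Hamilton1997, §2.1, Thm. 1.7 (proof, p. 11)] -/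
theorem largest_deriv_nonneg (hM : M.IsSymm) {m Ξ Ψ : ℝ} (hm : 0 < m) (hΞ : 0 < Ξ)
    (hΨ : 4 * Ξ ^ 2 + 1 ≤ Ψ) (h12 : M.TwoSmallestEigenvaluesSumGE m)
    (hA3 : ∀ u' z z' : Fin 3 → ℝ, u' ⬝ᵥ u' = 1 → z ⬝ᵥ z = 1 → z' ⬝ᵥ z' = 1 → z ⬝ᵥ z' = 0 →
      u' ⬝ᵥ (M *ᵥ u') ≤ Ξ * (z ⬝ᵥ (M *ᵥ z) + z' ⬝ᵥ (M *ᵥ z')))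
    (hB3 : ∀ u' v' z z' : Fin 3 → ℝ, u' ⬝ᵥ u' = 1 → v' ⬝ᵥ v' = 1 → z ⬝ᵥ z = 1 → z' ⬝ᵥ z' = 1 →
      z ⬝ᵥ z' = 0 → u' ⬝ᵥ (N *ᵥ v') ≤ Ξ * (z ⬝ᵥ (M *ᵥ z) + z' ⬝ᵥ (M *ᵥ z')))
    {u w : Fin 3 → ℝ} (hu : u ⬝ᵥ u = 1) (hw : w ⬝ᵥ w = 1)
    (hmax : ∀ z ∈ unitSet, z ⬝ᵥ (M *ᵥ z) ≤ u ⬝ᵥ (M *ᵥ u))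
    (hmin : ∀ z ∈ unitSet, w ⬝ᵥ (M *ᵥ w) ≤ z ⬝ᵥ (M *ᵥ z)) :
    0 ≤ Ψ * (w ⬝ᵥ ((M * M + N * Nᵀ + (2 : ℝ) • M.sharp) *ᵥ w)) -
      u ⬝ᵥ ((M * M + N * Nᵀ + (2 : ℝ) • M.sharp) *ᵥ u) := by
  have hu0 : ∀ z : Fin 3 → ℝ, z ⬝ᵥ u = 0 → u ⬝ᵥ (M *ᵥ z) = 0 :=
    fun z hz ↦ cross_eq_zero_of_max hM hu hmax hz
  have hw0 : ∀ z : Fin 3 → ℝ, z ⬝ᵥ w = 0 → w ⬝ᵥ (M *ᵥ z) = 0 :=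
    fun z hz ↦ cross_eq_zero_of_min hM hw hmin hz
  have hxy : w ⬝ᵥ (M *ᵥ w) ≤ u ⬝ᵥ (M *ᵥ u) := hmin u hu
  have hΨ1 : 1 ≤ Ψ := by nlinarith
  rcases hxy.eq_or_lt with heq | hlt
  · -- degenerate case: all Rayleigh quotients equal `x`; use bases through `u` and through `w`
    have hall : ∀ z : Fin 3 → ℝ, z ⬝ᵥ z = 1 → z ⬝ᵥ (M *ᵥ z) = w ⬝ᵥ (M *ᵥ w) :=
      fun z hz ↦ le_antisymm (by rw [heq]; exact hmax z hz) (hmin z hz)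
    -- every unit vector is then extremal, hence an eigenvector
    have hcross : ∀ e z : Fin 3 → ℝ, e ⬝ᵥ e = 1 → z ⬝ᵥ e = 0 → e ⬝ᵥ (M *ᵥ z) = 0 :=
      fun e z he hz ↦ cross_eq_zero_of_min hM he (fun z' hz' ↦ by rw [hall e he, hall z' hz']) hz
    obtain ⟨e₁, e₂, he₁, he₂, hue₁, hue₂, he₁₂⟩ := exists_orthonormal_complement hu
    obtain ⟨f₁, f₂, hf₁, hf₂, hwf₁, hwf₂, hf₁₂⟩ := exists_orthonormal_complement hw
    have Eu := quad_field_eq_of_diag (N := N) hM he₁ he₂ hu he₁₂ (by rw [dotProduct_comm]; exact hue₁)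
      (by rw [dotProduct_comm]; exact hue₂) (hcross e₁ e₂ he₁ (by rw [dotProduct_comm]; exact he₁₂))
      (hcross e₁ u he₁ hue₁) (hcross e₂ u he₂ hue₂)
    have Ew := quad_field_eq_of_diag (N := N) hM hf₁ hf₂ hw hf₁₂ (by rw [dotProduct_comm]; exact hwf₁)
      (by rw [dotProduct_comm]; exact hwf₂) (hcross f₁ f₂ hf₁ (by rw [dotProduct_comm]; exact hf₁₂))
      (hcross f₁ w hf₁ hwf₁) (hcross f₂ w hf₂ hwf₂)
    rw [Eu, Ew, hall e₁ he₁, hall e₂ he₂, hall f₁ hf₁, hall f₂ hf₂, hall u hu]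
    -- `x > 0` from `a₁ + a₂ ≥ m`; `|ᵗNu|² ≤ (2Ξx)²`
    have hxm := h12 w f₁ hw hf₁ hwf₁
    rw [hall f₁ hf₁] at hxm
    have hNu : (Nᵀ *ᵥ u) ⬝ᵥ (Nᵀ *ᵥ u) ≤ (Ξ * (w ⬝ᵥ (M *ᵥ w) + w ⬝ᵥ (M *ᵥ w))) ^ 2 := by
      refine normSq_mulTranspose_le_sq_of_bound (by nlinarith) fun v hv ↦ ?_
      have := hB3 u v w f₁ hu hv hw hf₁ hwf₁
      rwa [hall f₁ hf₁] at this
    have hNw : 0 ≤ (Nᵀ *ᵥ w) ⬝ᵥ (Nᵀ *ᵥ w) := Finset.sum_nonneg fun i _ ↦ mul_self_nonneg _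
    nlinarith [sq_nonneg (w ⬝ᵥ (M *ᵥ w)), mul_nonneg (by linarith : (0:ℝ) ≤ Ψ - 1) hNw,
      mul_nonneg (sq_nonneg Ξ) (sq_nonneg (w ⬝ᵥ (M *ᵥ w)))]
  · -- generic case: `u ⊥ w`, eigenbasis `(w, n, u)` with `n = w × u`
    have huw : u ⬝ᵥ w = 0 := dot_eq_zero_of_eigen hM hu hw hu0 hw0 hlt.ne
    have hwu : w ⬝ᵥ u = 0 := by rw [dotProduct_comm]; exact huw
    set n := w ⨯₃ u with hn
    have hn1 : n ⬝ᵥ n = 1 := dotProduct_cross_self_of_orthonormal hw hu hwu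
    have hwn : w ⬝ᵥ n = 0 := dot_self_cross w u
    have hun : u ⬝ᵥ n = 0 := dot_cross_self w u
    have hnw : n ⬝ᵥ w = 0 := by rw [dotProduct_comm]; exact hwn
    have hnu : n ⬝ᵥ u = 0 := by rw [dotProduct_comm]; exact hun
    -- cross terms vanish
    have cwn : w ⬝ᵥ (M *ᵥ n) = 0 := hw0 n hnw
    have cwu : w ⬝ᵥ (M *ᵥ u) = 0 := hw0 u huw
    have cnu : n ⬝ᵥ (M *ᵥ u) = 0 := by rw [quad_comm_of_isSymm hM]; exact hu0 n hnu
    have cun : u ⬝ᵥ (M *ᵥ n) = 0 := hu0 n hnu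
    have cnw : n ⬝ᵥ (M *ᵥ w) = 0 := by rw [quad_comm_of_isSymm hM]; exact cwn
    -- the two evaluations
    have Eu := quad_field_eq_of_diag (N := N) hM hw hn1 hu hwn hwu hnu cwn cwu cnu
    have cuw : u ⬝ᵥ (M *ᵥ w) = 0 := by rw [quad_comm_of_isSymm hM]; exact cwu
    have Ew := quad_field_eq_of_diag (N := N) hM hn1 hu hw hnu hnw huw cnu cnw cuw
    rw [Eu, Ew]
    -- the scalars: x = wᵀMw, a₂ = nᵀMn, y = uᵀMu
    have ha2x : w ⬝ᵥ (M *ᵥ w) ≤ n ⬝ᵥ (M *ᵥ n) := hmin n hn1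
    have ha2y : n ⬝ᵥ (M *ᵥ n) ≤ u ⬝ᵥ (M *ᵥ u) := hmax n hn1
    have hxm : m ≤ w ⬝ᵥ (M *ᵥ w) + n ⬝ᵥ (M *ᵥ n) := h12 w n hw hn1 hwn
    have hy : u ⬝ᵥ (M *ᵥ u) ≤ Ξ * (w ⬝ᵥ (M *ᵥ w) + n ⬝ᵥ (M *ᵥ n)) := hA3 u w n hu hw hn1 hwn
    have hNu : (Nᵀ *ᵥ u) ⬝ᵥ (Nᵀ *ᵥ u) ≤ (Ξ * (w ⬝ᵥ (M *ᵥ w) + n ⬝ᵥ (M *ᵥ n))) ^ 2 :=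
      normSq_mulTranspose_le_sq_of_bound (by nlinarith) fun v hv ↦ hB3 u v w n hu hv hw hn1 hwn
    have hNw : 0 ≤ (Nᵀ *ᵥ w) ⬝ᵥ (Nᵀ *ᵥ w) := Finset.sum_nonneg fun i _ ↦ mul_self_nonneg _
    have ha2 : 0 < n ⬝ᵥ (M *ᵥ n) := by linarith
    have hypos : 0 < u ⬝ᵥ (M *ᵥ u) := by linarith
    -- Hamilton: uᵀM'u ≤ (8Ξ² + 2) a₂² ≤ (8Ξ² + 2) a₂ y and wᵀM'w ≥ 2 a₂ y
    exact largest_scalar hΞ hΨ ha2x ha2y (by linarith) hy hNu hNw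

end HamiltonODE

end Literature.Geometry.Riemannian

end
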